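import Mathlib
import Summits.Ventures.HodgeRepro.Tier4.Common.LocalTorusCompactConj
import Summits.Ventures.HodgeRepro.Tier4.Common.TorusInfCompact
import Summits.Ventures.HodgeRepro.Tier4.Line4.ProjPlane

/-!
# Tier4/Common/TorusInfCompactConj — the `T′`-SIDE ARCHIMEDEAN TORUS `T′_∞ = T′(𝔸) ∩ G_∞` of the SEESAW PLANE is
COMPACT when every infinite place is a real CM place

Blind re-derivation cell `pub-hodge-repro`, Tier 4 «prove the step» (README §9–§10), seat t4-typer-2 (gen 4).
Target tree path `lean/Summits/Ventures/HodgeRepro/Tier4/Common/TorusInfCompactConj.lean`.  Imports: Mathlib,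
`Common.TorusInfCompact` (the `T`-side box `torusBoxAll` and `T_∞` compact for `ofLinesRow`),
`Common.LocalTorusCompactConj` (`map_conj_eq_one`, `continuous_conjMat`) and `Line4.ProjPlane` (the adelic inverse
pair `adMat_mul_adMat_eq_one`, `adMat_smul`, `adMat_transpose`).

WHY (plan-4 g3, bus S14649 C-L4-INTEG: (B2) `integrable_innerFn_full` and (B1) take `[CompactSpace (torusInf' W)]`,
(B1) also `[CompactSpace (torusInf W)]`): the seesaw plane is `(mixedRow q a₀ a₂).withTransportedTorus g g'`, its `T′` is
`g · T(mixedRow q a₁ a₃) · g′` under the wall's similitude display `hiso : g B₁ gᵀ = λ B₀` (`B_eq_of_similitude`,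
ProjPlane's `localTorusAt'_withTransportedTorus_conj` — here at the level of the WHOLE torus,
`torusT'_withTransportedTorus_conj`, the same proof without the place clause), and conjugation by the principal `g`
preserves `G_∞` (`infinitePart_conj`: `finM (g′ M g) = g′ · 1 · g = 1`).  So `T′_∞` is closed and lies inside the
preimage, under the closed embedding `g ↦ (g, g⁻¹)`, of the compact `g · torusBoxAll · g′` (TorusInfCompact's box for
`ofLinesRow q a₁ a₃ (-1)`): `isCompact_torusT'_inter_infinitePart_seesaw`, and the subtype / typeclass forms
`isCompact_infinitePart_subgroupOf_torusT'_seesaw`, `compactSpace_infinitePart_subgroupOf_torusT'_seesaw`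
(= `torusInf' W := (infinitePart W).subgroupOf (torusT' W)` of C-L4-TORUSPROD, by `rfl`).  Hypotheses: `hreal`, `hcm`
(every place real CM), `ha1 ha3` (the lines of the second row non-degenerate), `lam hlam hiso` (the similitude) —
exactly the binders of `compactSpace_localTorusAt'_seesaw` without the place.

Nothing here says anything about the status of the Hodge conjecture for CM abelian varieties, which is NOT proved
(HC_CM is NOT proved by anyone in this repository).
-/

set_option autoImplicit false

noncomputable section

namespace Summit.Ventures.HodgeRepro.Tier4.Common

open NumberField IsDedekindDomain Matrix Set Topology Summit.Ventures.HodgeRepro.Tier4.Line1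

section Conj

variable {k : Type} [Field k] [NumberField k]

/-- **The conjugate of an element of `G_∞` is in `G_∞`** (`g, g′` principal): for `κ' ∈ GA W₂` with
`mat κ' = g′ (mat κ) g` and `κ ∈ infinitePart W'`, `κ' ∈ infinitePart W₂`. -/
theorem infinitePart_conj {W' W₂ : PlaneData k} (g g' : Matrix (Fin 4) (Fin 4) k) (hA' : adMat k g' * adMat k g = 1)
    {κ : GA W'} (hκ : κ ∈ infinitePart W') {κ' : GA W₂}
    (h : GA.mat W₂ κ' = adMat k g' * GA.mat W' κ * adMat k g) : κ' ∈ infinitePart W₂ := by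
  rw [mem_infinitePart] at hκ ⊢
  rw [h]
  exact map_conj_eq_one (finPart k) g g' hA' hκ

variable (q : QuadData k) (a : Fin 4 → k)

/-- **`g′ T′ g` is the torus of the row plane `mixedRow q a₁ a₃`** under the wall's similitude display — the whole-torus
form of ProjPlane's `localTorusAt'_withTransportedTorus_conj` (same proof, no place clause). -/
theorem torusT'_withTransportedTorus_conj (g g' : Matrix (Fin 4) (Fin 4) k) (hgg' : g * g' = 1) (hg'g : g' * g = 1)
    (hgΩ : g * (PlaneData.mixedRow q (a 0) (a 2)).Ω = (PlaneData.mixedRow q (a 0) (a 2)).Ω * g)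
    (lam : k) (_hlam : lam ≠ 0)
    (hiso : g * (PlaneData.mixedRow q (a 1) (a 3)).B * gᵀ = lam • (PlaneData.mixedRow q (a 0) (a 2)).B) :
    ∀ κ ∈ torusT' ((PlaneData.mixedRow q (a 0) (a 2)).withTransportedTorus g g' hgg' hg'g hgΩ),
      ∃ κ' ∈ torusT (PlaneData.ofLinesRow q (a 1) (a 3) (-1)),
        GA.mat (PlaneData.ofLinesRow q (a 1) (a 3) (-1)) κ' =
          adMat k g' * GA.mat ((PlaneData.mixedRow q (a 0) (a 2)).withTransportedTorus g g' hgg' hg'g hgΩ) κ *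
            adMat k g := by
  intro κ hκT'
  -- the adelic inverse pair
  have hA : adMat k g * adMat k g' = 1 := Line4.adMat_mul_adMat_eq_one g g' hgg'
  have hA' : adMat k g' * adMat k g = 1 := Line4.adMat_mul_adMat_eq_one g' g hg'g
  -- notation for the matrices of the two planes (the same `Ω` and `P`, the forms `B₀`, `B₁`)
  set M : M4 k := GA.mat ((PlaneData.mixedRow q (a 0) (a 2)).withTransportedTorus g g' hgg' hg'g hgΩ) κ with hM
  set Ω : Matrix (Fin 4) (Fin 4) k := (PlaneData.mixedRow q (a 0) (a 2)).Ω with hΩdef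
  set B₀ : Matrix (Fin 4) (Fin 4) k := (PlaneData.mixedRow q (a 0) (a 2)).B with hB₀def
  set B₁ : Matrix (Fin 4) (Fin 4) k := (PlaneData.mixedRow q (a 1) (a 3)).B with hB₁def
  set P : Fin 2 → Matrix (Fin 4) (Fin 4) k := (PlaneData.mixedRow q (a 0) (a 2)).P with hPdef
  -- the unitary relations of `κ`
  have hΩ : M * adMat k Ω = adMat k Ω * M := κ.2.1
  have hB : M * adMat k B₀ * Mᵀ = adMat k B₀ := κ.2.2
  -- `κ` commutes with the transported projectors `Q i = g P i g'`
  have hQ : ∀ i, M * adMat k (g * P i * g') = adMat k (g * P i * g') * M := by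
    intro i
    fin_cases i
    · exact hκT'.1
    · exact hκT'.2
  -- the conjugate matrix
  set M' : M4 k := adMat k g' * M * adMat k g with hM'
  -- (a) `M'` commutes with `P i`
  have hP' : ∀ i, M' * adMat k (P i) = adMat k (P i) * M' := by
    intro i
    have h := hQ i
    rw [adMat_mul, adMat_mul] at h
    have e1 : M' * adMat k (P i) = adMat k g' * ((M * (adMat k g * adMat k (P i) * adMat k g')) * adMat k g) := by
      rw [hM']
      simp only [Matrix.mul_assoc]
      rw [hA', Matrix.mul_one]
    rw [e1, h, hM']
    simp only [Matrix.mul_assoc]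
    rw [← Matrix.mul_assoc (adMat k g') (adMat k g), hA', Matrix.one_mul]
  -- (b) `M'` commutes with `Ω`
  have h1 : adMat k g * adMat k Ω = adMat k Ω * adMat k g := by
    rw [← adMat_mul, ← adMat_mul]
    exact congrArg (adMat k) hgΩ
  have hgΩ' : adMat k g' * adMat k Ω = adMat k Ω * adMat k g' := by
    have e : adMat k g' * adMat k Ω = adMat k g' * (adMat k Ω * adMat k g) * adMat k g' := by
      rw [Matrix.mul_assoc, Matrix.mul_assoc, hA, Matrix.mul_one]
    rw [e, ← h1, ← Matrix.mul_assoc, hA', Matrix.one_mul]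
  have hΩ' : M' * adMat k Ω = adMat k Ω * M' := by
    rw [hM']
    calc adMat k g' * M * adMat k g * adMat k Ω = adMat k g' * M * (adMat k g * adMat k Ω) := by
          rw [Matrix.mul_assoc]
      _ = adMat k g' * M * (adMat k Ω * adMat k g) := by rw [h1]
      _ = adMat k g' * (M * adMat k Ω) * adMat k g := by simp only [Matrix.mul_assoc]
      _ = adMat k g' * (adMat k Ω * M) * adMat k g := by rw [hΩ]
      _ = (adMat k g' * adMat k Ω) * M * adMat k g := by simp only [Matrix.mul_assoc]
      _ = (adMat k Ω * adMat k g') * M * adMat k g := by rw [hgΩ']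
      _ = adMat k Ω * (adMat k g' * M * adMat k g) := by simp only [Matrix.mul_assoc]
  -- (c) `B₁ = λ · g' B₀ g'ᵀ` and `M'` preserves `B₁`
  have hB₁ : B₁ = lam • (g' * B₀ * g'ᵀ) := by
    have e : B₁ = g' * (g * B₁ * gᵀ) * g'ᵀ := by
      calc B₁ = (g' * g) * B₁ * (g' * g)ᵀ := by
            rw [hg'g, Matrix.transpose_one, Matrix.one_mul, Matrix.mul_one]
        _ = g' * (g * B₁ * gᵀ) * g'ᵀ := by
            rw [Matrix.transpose_mul]
            simp only [Matrix.mul_assoc]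
    rw [e, hiso, Matrix.mul_smul, Matrix.smul_mul]
  have hB₁A : adMat k B₁ = algebraMap k (Ad k) lam • (adMat k g' * adMat k B₀ * (adMat k g')ᵀ) := by
    rw [hB₁, Line4.adMat_smul, adMat_mul, adMat_mul, Line4.adMat_transpose]
  have hB' : M' * adMat k B₁ * M'ᵀ = adMat k B₁ := by
    have hT : (adMat k g')ᵀ * (adMat k g)ᵀ = 1 := by
      rw [← Matrix.transpose_mul, hA, Matrix.transpose_one]
    have key : M' * (adMat k g' * adMat k B₀ * (adMat k g')ᵀ) * M'ᵀ = adMat k g' * adMat k B₀ * (adMat k g')ᵀ := by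
      rw [hM']
      calc adMat k g' * M * adMat k g * (adMat k g' * adMat k B₀ * (adMat k g')ᵀ) * (adMat k g' * M * adMat k g)ᵀ
          = adMat k g' * (M * ((adMat k g * adMat k g') *
              (adMat k B₀ * (((adMat k g')ᵀ * (adMat k g)ᵀ) * (Mᵀ * (adMat k g')ᵀ))))) := by
            rw [Matrix.transpose_mul, Matrix.transpose_mul]
            simp only [Matrix.mul_assoc]
        _ = adMat k g' * (M * (adMat k B₀ * (Mᵀ * (adMat k g')ᵀ))) := by
            rw [hA, Matrix.one_mul, hT, Matrix.one_mul]
        _ = adMat k g' * ((M * adMat k B₀ * Mᵀ) * (adMat k g')ᵀ) := by simp only [Matrix.mul_assoc]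
        _ = adMat k g' * adMat k B₀ * (adMat k g')ᵀ := by rw [hB]; simp only [Matrix.mul_assoc]
    rw [hB₁A, Matrix.mul_smul, Matrix.smul_mul, key]
  -- `M'` is a unit: `adMat g'`, `M`, `adMat g` are
  let ug : (M4 k)ˣ := ⟨adMat k g, adMat k g', hA, hA'⟩
  let ug' : (M4 k)ˣ := ⟨adMat k g', adMat k g, hA', hA⟩
  let u : (M4 k)ˣ := ug' * (κ : GL4 k) * ug
  have hu : (u : M4 k) = M' := by
    rw [hM']
    show ((ug' * (κ : GL4 k) * ug : (M4 k)ˣ) : M4 k) = _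
    rw [Units.val_mul, Units.val_mul]
  have humem : u ∈ unitaryGroup (PlaneData.ofLinesRow q (a 1) (a 3) (-1)) := by
    rw [mem_unitaryGroup, hu]
    exact ⟨hΩ', hB'⟩
  refine ⟨⟨u, humem⟩, ⟨hP' 0, hP' 1⟩, ?_⟩
  show (u : M4 k) = M'
  exact hu

/-- **THE `T′`-SIDE ARCHIMEDEAN TORUS OF THE SEESAW PLANE IS COMPACT** when every infinite place is a real CM place
(with `a 1 ≠ 0`, `a 3 ≠ 0`): its elements are conjugate by `g` into `T_∞` of `mixedRow q a₁ a₃`, whose matrices lie in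
`torusBoxAll`. -/
theorem isCompact_torusT'_inter_infinitePart_seesaw (g g' : Matrix (Fin 4) (Fin 4) k) (hgg' : g * g' = 1)
    (hg'g : g' * g = 1)
    (hgΩ : g * (PlaneData.mixedRow q (a 0) (a 2)).Ω = (PlaneData.mixedRow q (a 0) (a 2)).Ω * g)
    (lam : k) (hlam : lam ≠ 0)
    (hiso : g * (PlaneData.mixedRow q (a 1) (a 3)).B * gᵀ = lam • (PlaneData.mixedRow q (a 0) (a 2)).B)
    (ha1 : a 1 ≠ 0) (ha3 : a 3 ≠ 0) (hreal : ∀ w : InfinitePlace k, w.IsReal) (hcm : ∀ w, IsCMAt q w) :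
    IsCompact ((torusT' ((PlaneData.mixedRow q (a 0) (a 2)).withTransportedTorus g g' hgg' hg'g hgΩ) :
        Set (GA ((PlaneData.mixedRow q (a 0) (a 2)).withTransportedTorus g g' hgg' hg'g hgΩ))) ∩
      (infinitePart ((PlaneData.mixedRow q (a 0) (a 2)).withTransportedTorus g g' hgg' hg'g hgΩ) :
        Set (GA ((PlaneData.mixedRow q (a 0) (a 2)).withTransportedTorus g g' hgg' hg'g hgΩ)))) := by
  have hA : adMat k g * adMat k g' = 1 := Line4.adMat_mul_adMat_eq_one g g' hgg'
  have hA' : adMat k g' * adMat k g = 1 := Line4.adMat_mul_adMat_eq_one g' g hg'g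
  have hε : (-1 : k) ≠ 0 := neg_ne_zero.2 one_ne_zero
  set W := (PlaneData.mixedRow q (a 0) (a 2)).withTransportedTorus g g' hgg' hg'g hgΩ with hW
  set C : InfinitePlace k → ℝ := fun w => blockBound q w with hC
  -- the compact set of conjugated box matrices
  set K : Set (M4 k) := (fun M : M4 k => adMat k g * M * adMat k g') '' torusBoxAll hreal C with hK
  have hKc : IsCompact K := (isCompact_torusBoxAll hreal C).image (continuous_conjMat g g')
  have hP : IsCompact (K ×ˢ (MulOpposite.op '' K)) := hKc.prod (hKc.image MulOpposite.continuous_op)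
  have hpre : IsCompact ((fun x : GA W => Units.embedProduct (M4 k) (x : GL4 k)) ⁻¹' (K ×ˢ (MulOpposite.op '' K))) :=
    (isClosedEmbedding_embed W).isCompact_preimage hP
  refine hpre.of_isClosed_subset ((isClosed_torusT' W).inter (isClosed_infinitePart W)) ?_
  -- every element of `T′_∞` has its matrix in `K`
  have hmem : ∀ κ : GA W, κ ∈ torusT' W → κ ∈ infinitePart W → GA.mat W κ ∈ K := by
    intro κ hκT' hκinf
    obtain ⟨κ', hκ'T, hκ'mat⟩ := torusT'_withTransportedTorus_conj q a g g' hgg' hg'g hgΩ lam hlam hiso κ hκT'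
    have hκ'inf : κ' ∈ infinitePart (PlaneData.ofLinesRow q (a 1) (a 3) (-1)) :=
      infinitePart_conj g g' hA' hκinf hκ'mat
    refine ⟨GA.mat _ κ', mem_torusBoxAll_of_mem_torusT_of_mem_infinitePart q (a 1) (a 3) (-1) ha1 ha3 hε hreal hcm
      hκ'T hκ'inf, ?_⟩
    rw [hκ'mat]
    calc adMat k g * (adMat k g' * GA.mat W κ * adMat k g) * adMat k g'
        = (adMat k g * adMat k g') * GA.mat W κ * (adMat k g * adMat k g') := by simp only [Matrix.mul_assoc]
      _ = GA.mat W κ := by rw [hA, Matrix.one_mul, Matrix.mul_one]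
  rintro κ ⟨hκT', hκinf⟩
  show Units.embedProduct (M4 k) (κ : GL4 k) ∈ K ×ˢ (MulOpposite.op '' K)
  rw [Units.embedProduct_apply]
  refine ⟨hmem κ hκT' hκinf, ?_⟩
  refine ⟨GA.mat W κ⁻¹, hmem κ⁻¹ ((torusT' W).inv_mem hκT') ((infinitePart W).inv_mem hκinf), ?_⟩
  rfl

/-- The same statement inside `T′(𝔸)`: the carrier of `(infinitePart W).subgroupOf (torusT' W)` (= `torusInf' W` of
C-L4-TORUSPROD) is a compact subset of `torusT' W`. -/
theorem isCompact_infinitePart_subgroupOf_torusT'_seesaw (g g' : Matrix (Fin 4) (Fin 4) k) (hgg' : g * g' = 1)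
    (hg'g : g' * g = 1)
    (hgΩ : g * (PlaneData.mixedRow q (a 0) (a 2)).Ω = (PlaneData.mixedRow q (a 0) (a 2)).Ω * g)
    (lam : k) (hlam : lam ≠ 0)
    (hiso : g * (PlaneData.mixedRow q (a 1) (a 3)).B * gᵀ = lam • (PlaneData.mixedRow q (a 0) (a 2)).B)
    (ha1 : a 1 ≠ 0) (ha3 : a 3 ≠ 0) (hreal : ∀ w : InfinitePlace k, w.IsReal) (hcm : ∀ w, IsCMAt q w) :
    IsCompact (((infinitePart ((PlaneData.mixedRow q (a 0) (a 2)).withTransportedTorus g g' hgg' hg'g hgΩ)).subgroupOf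
      (torusT' ((PlaneData.mixedRow q (a 0) (a 2)).withTransportedTorus g g' hgg' hg'g hgΩ)) :
        Subgroup (torusT' ((PlaneData.mixedRow q (a 0) (a 2)).withTransportedTorus g g' hgg' hg'g hgΩ))) :
      Set (torusT' ((PlaneData.mixedRow q (a 0) (a 2)).withTransportedTorus g g' hgg' hg'g hgΩ))) := by
  set W := (PlaneData.mixedRow q (a 0) (a 2)).withTransportedTorus g g' hgg' hg'g hgΩ with hW
  have hemb : Topology.IsClosedEmbedding (Subtype.val : torusT' W → GA W) :=
    (isClosed_torusT' W).isClosedEmbedding_subtypeVal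
  have hc := hemb.isCompact_preimage
    (isCompact_torusT'_inter_infinitePart_seesaw q a g g' hgg' hg'g hgΩ lam hlam hiso ha1 ha3 hreal hcm)
  refine hc.of_isClosed_subset ?_ ?_
  · rw [Subgroup.coe_subgroupOf]
    exact (isClosed_infinitePart W).preimage continuous_subtype_val
  · intro t ht
    exact ⟨t.2, Subgroup.mem_subgroupOf.1 ht⟩

/-- The typeclass form: `(infinitePart W).subgroupOf (torusT' W)` is a compact space for the seesaw plane. -/
theorem compactSpace_infinitePart_subgroupOf_torusT'_seesaw (g g' : Matrix (Fin 4) (Fin 4) k) (hgg' : g * g' = 1)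
    (hg'g : g' * g = 1)
    (hgΩ : g * (PlaneData.mixedRow q (a 0) (a 2)).Ω = (PlaneData.mixedRow q (a 0) (a 2)).Ω * g)
    (lam : k) (hlam : lam ≠ 0)
    (hiso : g * (PlaneData.mixedRow q (a 1) (a 3)).B * gᵀ = lam • (PlaneData.mixedRow q (a 0) (a 2)).B)
    (ha1 : a 1 ≠ 0) (ha3 : a 3 ≠ 0) (hreal : ∀ w : InfinitePlace k, w.IsReal) (hcm : ∀ w, IsCMAt q w) :
    CompactSpace ((infinitePart ((PlaneData.mixedRow q (a 0) (a 2)).withTransportedTorus g g' hgg' hg'g hgΩ)).subgroupOf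
      (torusT' ((PlaneData.mixedRow q (a 0) (a 2)).withTransportedTorus g g' hgg' hg'g hgΩ))) :=
  isCompact_iff_compactSpace.1
    (isCompact_infinitePart_subgroupOf_torusT'_seesaw q a g g' hgg' hg'g hgΩ lam hlam hiso ha1 ha3 hreal hcm)

end Conj

end Summit.Ventures.HodgeRepro.Tier4.Common

end
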